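import Summits.QuantumFields.YangMills.Theorems.UnitScaleTiltProp7TorusGreen2HeatKernel
import Summits.QuantumFields.YangMills.Theorems.UnitScaleTiltProp7TorusHeatKernelSmallDistance
import HarnessLib

/-!
# Route `UnitScaleTilt`, crux K1 «MinimiserStabilityRegPr» (stmt-QuantumFields-19200), route-R E′ path (α′), residue (hK), far-field fork (A3), row (R2): THE FIRST DIFFERENCE OF THE
# BIHARMONIC TORUS GREEN FUNCTION IS BOUNDED — `|G̃₂(z+eᵢ) − G̃₂(z)| ≤ C` ON `(ℤ/Lℤ)³`, UNIFORMLY IN THE PERIOD `L` AND IN `z` (via the small-distance heat-kernel letter (R1))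

Cell `ym3-torus`, width seat `ym3-torus-px13` (gen 2); ★routeR-w3 g5 NAMING 2026-08-28T19:28:35Z «px13: (R2) G̃₂ FIRST DIFFERENCE O(1) — type with (R1) displayed as a hypothesis,
discharge by `exact` when it lands» (+ ★★OWNER g28 CONDUCT WORD 2; (R1) = routeR-w2 g5 ✓ `…Prop7TorusHeatKernelSmallDistance.abs_torusHeatKernel_fwdDiff_le_small`, imported and
discharged in §5; (R3) = ★w8-19200 g7).  `--supports stmt-QuantumFields-19200`, count-neutral.  THEOREMS ONLY (0 `def`, 0 `sorry`).  YM₃ on T³ is a ladder rung (R3), not the Clay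
problem; nothing here claims the stub, the crux, d = 4 or the gap.

THE POINT.  `G̃₂(z) = L⁻³Σ_{k≠0}cos(p_k·z)∕ε(p_k)²` is the lattice, finite-volume form of `c·|x|` (the biharmonic potential of `ℝ³`), so its GRADIENT is `O(1)` — but the naive heat-kernel count
`∫₀^{L²} s·|∇ᵢ[∏_μq^L_s]| ds ≲ ∫₀^{L²} s·(1∨s)⁻²ds ≍ log L` diverges (★routeR-w3 g5 19:08:11Z warning).  The cure is the SMALL-DISTANCE factor of the one-dimensional forward difference,
`|q^L_t(m+1) − q^L_t(m)| ≲ ((|m̃|+1)∕t)·(1∨t)^{−1∕2}·(1 + m̃²∕(1∨t))⁻³` (row (R1), routeR-w2 g5: Bessel's recurrence `q_t(m−1) − q_t(m+1) = (2m∕t)q_t(m)` + odd pairing of the periodised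
images), DISPLAYED here as the hypothesis `h1` with its constant `K₁`: with it `s·|∇ᵢ[∏_μq^L_s](z)| ≤ K·(|z̃ᵢ|+1)·T√T·((T + z̃ᵢ²)³)⁻¹` (`T = 1∨s`; the Gaussian weight is kept AT THE
DIFFERENCED COORDINATE `i`), and `(|z̃ᵢ|+1)·T√T·(T+z̃ᵢ²)⁻³ ≤ 27(|z̃ᵢ|+1)·((s + (|z̃ᵢ|+1)²)·√(s + (|z̃ᵢ|+1)²))⁻¹`, whose time integral is `≤ 54` by the one half-power antiderivative
`∫₀^S((s+c)√(s+c))⁻¹ds = 2∕√c − 2∕√(S+c)` (the `s^{−3∕2}` large-time decay of `s·∇q_s` is intrinsic, so — unlike the Hessian rows ✓p661087 — no AM–GM to integer powers is possible).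
The Fourier tail at `S = L²` is ✓ `…TorusGreen2HeatKernel.abs_torusGreen2_grad_tail_le` (`≤ (π∕16)C₁³`, L-uniform in `d = 3`).

WHAT IS PROVED (ns `…Theorems.Prop7TorusGreen2GradientBound`; carrier `TorusSite 3 L = Fin 3 → ZMod L`; `G̃₂` in the displayed-definition currency of (R3): `(G : TorusSite 3 L → ℝ)
(hG : ∀ z, G z = (Σ_{k ∈ univ.erase 0} Real.cos (Σ i, latticeMomentum L k i * ((z i).val : ℝ)) ∕ dispersion (latticeMomentum L k) ^ 2) ∕ (L : ℝ) ^ 3)`, instantiated by `rfl`).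
* §1 `integral_inv_mul_sqrt_le` — `∫₀^S ((s + c)·√(s + c))⁻¹ ds ≤ 2∕√c` (`c > 0`, `S ≥ 0`).
* §2 ★★ `mul_abs_grad_prod_torusHeatKernel_le_of_smallDist` — from the displayed row `h1`: `∃ K > 0, ∀ L s (0 < s ≤ L²) (z : TorusSite 3 L) i,
  s·|∏_μq^L_s((z+eᵢ)_μ) − ∏_μq^L_s(z_μ)| ≤ K·(|z̃ᵢ|+1)·((1∨s)·√(1∨s))·(((1∨s) + z̃ᵢ²)³)⁻¹`.
* §3 `pointwise_majorant` — `(a+1)·T√T·((T+a²)³)⁻¹ ≤ 27(a+1)·((s+(a+1)²)·√(s+(a+1)²))⁻¹` for `a ≥ 0`, `0 ≤ s ≤ T`, `1 ≤ T`.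
* §4 ★★ `abs_torusGreen2_grad_le_of_smallDist` — from `h1`: `∃ C, ∀ L ≥ 1, ∀ G (hG), ∀ i z, |G(z+eᵢ) − G(z)| ≤ C` (`C = 54K + (π∕16)C₁³`; NO `z ≠ 0` needed).
* §5 ★★★ `abs_torusGreen2_grad_le` — THE UNCONDITIONAL ROW (R2): `∃ C, ∀ L ≥ 1, ∀ G (hG), ∀ i z, |G(z+eᵢ) − G(z)| ≤ C`, `h1` discharged by routeR-w2 g5's (R1)
  ✓ `abs_torusHeatKernel_fwdDiff_le_small` (Bessel recurrence + odd pairing of the periodised images).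
HONEST SCOPE.  A Literature-grade lattice lemma placed in the Summits lineage that consumes it ((A3) of (hK)); no Yang–Mills statement is touched; the `Tor (fine ℓ M)`∕`Site (F.P K) 0`
reading is row (R5); the second∕third differences of `G̃₂` are row (R3).

References: G. F. Lawler, V. Limic, *Random Walk: A Modern Introduction*, CUP 2010, Ch. 4, §6.3 [LawlerLimic2010]; T. Bałaban, CMP 96 (1984) 223–250 [Balaban1984PropagatorsII]
((1.9) p.226); CMP 99 (1985) 75–102 [Balaban1985RegularSpaces] ((1.36) p.82).
-/

set_option autoImplicit false

noncomputable section

open MeasureTheory Set Finset ZMod intervalIntegral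
open scoped Real BigOperators ComplexConjugate

namespace Summit.QuantumFields.YangMills.Theorems.Prop7TorusGreen2GradientBound

open Literature.Probability.LatticeModels
open Prop7TorusGreenGradientBricks (grad_prod prod_le_apply_of_le_one')
open Prop7TorusGreen2HeatKernel (torusGreen2_grad_eq abs_torusGreen2_grad_tail_le)
open Prop7TorusHeatKernelSmallDistance (abs_torusHeatKernel_fwdDiff_le_small)

variable {L : ℕ}

/-! ## §1 The half-power time integral -/

/-- **`∫₀^S ((s + c)·√(s + c))⁻¹ ds ≤ 2∕√c`** for `c > 0`, `S ≥ 0` (the antiderivative is `−2∕√(s + c)`; the exact value is `2∕√c − 2∕√(S+c)`). [folklore] -/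
theorem integral_inv_mul_sqrt_le {c S : ℝ} (hc : 0 < c) (hS : 0 ≤ S) :
    ∫ s in (0 : ℝ)..S, ((s + c) * Real.sqrt (s + c))⁻¹ ≤ 2 / Real.sqrt c := by
  have hderiv : ∀ s ∈ Set.uIcc (0 : ℝ) S,
      HasDerivAt (fun s : ℝ => -2 * (Real.sqrt (s + c))⁻¹) (((s + c) * Real.sqrt (s + c))⁻¹) s := by
    intro s hs
    rw [Set.uIcc_of_le hS] at hs
    have hsc : 0 < s + c := by linarith [hs.1]
    have hsq : Real.sqrt (s + c) ≠ 0 := (Real.sqrt_pos.2 hsc).ne'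
    have h1 : HasDerivAt (fun s : ℝ => Real.sqrt (s + c)) (1 / (2 * Real.sqrt (s + c))) s := by
      have h := ((hasDerivAt_id s).add_const c).sqrt hsc.ne'
      simpa using h
    have h2 := (h1.inv hsq).const_mul (-2 : ℝ)
    have e : (-2 : ℝ) * (-(1 / (2 * Real.sqrt (s + c))) / Real.sqrt (s + c) ^ 2) = ((s + c) * Real.sqrt (s + c))⁻¹ := by
      have hss : Real.sqrt (s + c) ^ 2 = s + c := Real.sq_sqrt hsc.le
      rw [hss]
      field_simp
    rw [e] at h2
    exact h2
  have hcont : ContinuousOn (fun s : ℝ => ((s + c) * Real.sqrt (s + c))⁻¹) (Set.uIcc (0 : ℝ) S) := by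
    rw [Set.uIcc_of_le hS]
    refine ContinuousOn.inv₀ (by fun_prop) fun s hs => ?_
    have hsc : 0 < s + c := by linarith [hs.1]
    have : 0 < Real.sqrt (s + c) := Real.sqrt_pos.2 hsc
    positivity
  rw [intervalIntegral.integral_eq_sub_of_hasDerivAt hderiv (hcont.intervalIntegrable)]
  simp only [zero_add]
  have hpos : 0 < (Real.sqrt (S + c))⁻¹ := by
    have : 0 < Real.sqrt (S + c) := Real.sqrt_pos.2 (by linarith)
    positivity
  rw [div_eq_mul_inv]
  linarith

/-! ## §2 ★★ The `s`-weighted gradient of the product heat kernel from the small-distance letter -/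

/-- ★★ **From the displayed SMALL-DISTANCE forward-difference row `h1` of the one-dimensional torus heat kernel** (row (R1): `|q^L_t(m+1) − q^L_t(m)| ≤ K₁·((|m̃|+1)∕t)·(1∨t)^{−1∕2}·(1 + m̃²∕(1∨t))⁻³`
for `0 < t ≤ L²`): there is `K > 0` such that for all `L ≥ 1`, `0 < s ≤ L²`, `z ∈ (ℤ/Lℤ)³` and every direction `i`,
`s·|∏_μ q^L_s((z+eᵢ)_μ) − ∏_μ q^L_s(z_μ)| ≤ K·(|z̃ᵢ|+1)·((1∨s)√(1∨s))·(((1∨s) + z̃ᵢ²)³)⁻¹` — the differenced factor gives `(|z̃ᵢ|+1)∕s·(1∨s)^{−1∕2}`, the two plain ones `(1∨s)^{−1∕2}` each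
(✓ `abs_torusHeatKernel_le`), every factor a Gaussian weight `≤ 1` of which the one AT THE COORDINATE `i` is kept: `(1∨s)^{−3∕2}·(1 + z̃ᵢ²∕(1∨s))⁻³ = (1∨s)√(1∨s)·((1∨s)+z̃ᵢ²)⁻³`. [folklore] -/
theorem mul_abs_grad_prod_torusHeatKernel_le_of_smallDist {K₁ : ℝ}
    (h1 : ∀ (L : ℕ) [NeZero L] (t : ℝ), 0 < t → t ≤ (L : ℝ) ^ 2 → ∀ m : ZMod L,
      |torusHeatKernel t (m + 1) - torusHeatKernel t m| ≤
        K₁ * ((|((m.valMinAbs : ℤ) : ℝ)| + 1) / t) * (max 1 t) ^ (-(1 / 2 : ℝ)) * ((1 + ((m.valMinAbs : ℤ) : ℝ) ^ 2 / max 1 t) ^ 3)⁻¹) :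
    ∃ K : ℝ, 0 < K ∧ ∀ (L : ℕ) [NeZero L] (s : ℝ), 0 < s → s ≤ (L : ℝ) ^ 2 → ∀ (z : TorusSite 3 L) (i : Fin 3),
      s * |(∏ μ, torusHeatKernel s ((z + Pi.single i 1 : TorusSite 3 L) μ)) - ∏ μ, torusHeatKernel s (z μ)|
        ≤ K * (|(((z i).valMinAbs : ℤ) : ℝ)| + 1) * ((max 1 s) * Real.sqrt (max 1 s)) * (((max 1 s) + (((z i).valMinAbs : ℤ) : ℝ) ^ 2) ^ 3)⁻¹ := by
  obtain ⟨K₀, hK₀, h₀⟩ := abs_torusHeatKernel_le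
  set K : ℝ := max K₀ K₁ with hK
  have hK0 : K₀ ≤ K := le_max_left _ _
  have hK1 : K₁ ≤ K := le_max_right _ _
  have hKpos : 0 < K := hK₀.trans_le hK0
  refine ⟨K ^ 3, by positivity, ?_⟩
  intro L _ s hs hsL z i
  set T : ℝ := max 1 s with hT
  have hT1 : 1 ≤ T := le_max_left _ _
  have hT0 : 0 < T := by positivity
  set σ : ℝ := T ^ (-(1 / 2 : ℝ)) with hσ
  have hσ0 : 0 < σ := Real.rpow_pos_of_pos hT0 _
  have hσσ : σ * σ = T⁻¹ := max_one_rpow_neg_half_mul_self s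
  have hσT : σ * T = Real.sqrt T := by
    rw [Real.sqrt_eq_rpow, hσ]
    have e : T ^ (-(1 / 2 : ℝ)) * T = T ^ (-(1 / 2 : ℝ)) * T ^ (1 : ℝ) := by rw [Real.rpow_one]
    rw [e, ← Real.rpow_add hT0]
    norm_num
  set a : ℝ := |(((z i).valMinAbs : ℤ) : ℝ)| with ha
  have ha0 : 0 ≤ a := abs_nonneg _
  -- the Gaussian weights
  set W : Fin 3 → ℝ := fun μ => ((1 + (((z μ).valMinAbs : ℤ) : ℝ) ^ 2 / T) ^ 3)⁻¹ with hW
  have hW0 : ∀ μ, 0 ≤ W μ := fun μ => by positivity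
  have hW1 : ∀ μ, W μ ≤ 1 := fun μ => by
    rw [hW]
    exact inv_le_one_of_one_le₀ (one_le_pow₀ (by
      have : 0 ≤ (((z μ).valMinAbs : ℤ) : ℝ) ^ 2 / T := by positivity
      linarith))
  have hWi : ∏ μ, W μ ≤ W i := prod_le_apply_of_le_one' hW0 hW1 i
  -- the one-dimensional bounds with the common constant `K`
  have b₀ : ∀ m : ZMod L, |torusHeatKernel s m| ≤ K * σ * ((1 + ((m.valMinAbs : ℤ) : ℝ) ^ 2 / T) ^ 3)⁻¹ := fun m =>
    (h₀ L s hs hsL m).trans (by gcongr)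
  have b₁ : |torusHeatKernel s (z i + 1) - torusHeatKernel s (z i)| ≤ K * ((a + 1) / s) * σ * W i :=
    (h1 L s hs hsL (z i)).trans (by rw [hW, ha]; gcongr)
  -- the target weight: `K³·((a+1)/s)·σ³·W i = K³·((a+1)/s)·T√T·((T + a²)³)⁻¹`
  have hWa : W i = ((1 + a ^ 2 / T) ^ 3)⁻¹ := by rw [hW, ha, sq_abs]
  have htarget : K ^ 3 * ((a + 1) / s) * (σ * T⁻¹) * W i = K ^ 3 * (a + 1) * (T * Real.sqrt T) * ((T + a ^ 2) ^ 3)⁻¹ / s := by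
    rw [← hσT, hWa]
    have hTne : T ≠ 0 := hT0.ne'
    have hsne : s ≠ 0 := hs.ne'
    field_simp
  have hfinal : K ^ 3 * (a + 1) * (T * Real.sqrt T) * ((T + a ^ 2) ^ 3)⁻¹ / s =
      s⁻¹ * (K ^ 3 * (a + 1) * (T * Real.sqrt T) * ((T + a ^ 2) ^ 3)⁻¹) := by
    rw [div_eq_inv_mul]
  -- the product
  rw [grad_prod (fun m => torusHeatKernel s m) z i, abs_mul, Finset.abs_prod]
  have hcard : ((univ : Finset (Fin 3)).erase i).card = 2 := by
    rw [Finset.card_erase_of_mem (Finset.mem_univ i), Finset.card_univ, Fintype.card_fin]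
  have hrest : ∏ μ ∈ (univ : Finset (Fin 3)).erase i, |torusHeatKernel s (z μ)| ≤ ∏ μ ∈ (univ : Finset (Fin 3)).erase i, (K * σ * W μ) :=
    Finset.prod_le_prod (fun μ _ => abs_nonneg _) fun μ _ => b₀ (z μ)
  have hprod : |torusHeatKernel s (z i + 1) - torusHeatKernel s (z i)| * ∏ μ ∈ (univ : Finset (Fin 3)).erase i, |torusHeatKernel s (z μ)|
      ≤ K ^ 3 * ((a + 1) / s) * (σ * T⁻¹) * W i := by
    calc |torusHeatKernel s (z i + 1) - torusHeatKernel s (z i)| * ∏ μ ∈ (univ : Finset (Fin 3)).erase i, |torusHeatKernel s (z μ)|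
        ≤ (K * ((a + 1) / s) * σ * W i) * ∏ μ ∈ (univ : Finset (Fin 3)).erase i, (K * σ * W μ) :=
          mul_le_mul b₁ hrest (Finset.prod_nonneg fun μ _ => abs_nonneg _) (by positivity)
      _ = K ^ 3 * ((a + 1) / s) * (σ * (σ * σ)) * (W i * ∏ μ ∈ (univ : Finset (Fin 3)).erase i, W μ) := by
          rw [Finset.prod_mul_distrib, Finset.prod_const, hcard]
          ring
      _ = K ^ 3 * ((a + 1) / s) * (σ * T⁻¹) * ∏ μ, W μ := by
          rw [hσσ, Finset.mul_prod_erase _ _ (Finset.mem_univ i)]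
      _ ≤ K ^ 3 * ((a + 1) / s) * (σ * T⁻¹) * W i := by gcongr
  rw [htarget, hfinal] at hprod
  rw [ha] at hprod ⊢
  calc s * (|torusHeatKernel s (z i + 1) - torusHeatKernel s (z i)| * ∏ μ ∈ (univ : Finset (Fin 3)).erase i, |torusHeatKernel s (z μ)|)
      ≤ s * (s⁻¹ * (K ^ 3 * (|(((z i).valMinAbs : ℤ) : ℝ)| + 1) * (T * Real.sqrt T) * ((T + |(((z i).valMinAbs : ℤ) : ℝ)| ^ 2) ^ 3)⁻¹)) :=
        mul_le_mul_of_nonneg_left hprod hs.le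
    _ = K ^ 3 * (|(((z i).valMinAbs : ℤ) : ℝ)| + 1) * (T * Real.sqrt T) * ((T + (((z i).valMinAbs : ℤ) : ℝ) ^ 2) ^ 3)⁻¹ := by
        rw [sq_abs, ← mul_assoc, mul_inv_cancel₀ hs.ne', one_mul]

/-! ## §3 The pointwise majorant -/

/-- **The pointwise majorant of the time integrand**: for `a ≥ 0`, `0 ≤ s ≤ T`, `1 ≤ T`,
`(a+1)·T√T·((T + a²)³)⁻¹ ≤ 27·(a+1)·((s + (a+1)²)·√(s + (a+1)²))⁻¹` (`3(T + a²) ≥ T + (a+1)²` since `T ≥ 1`; `T√T ≤ (T+b²)√(T+b²)`; then `s ≤ T`). [folklore] -/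
theorem pointwise_majorant {a s T : ℝ} (ha : 0 ≤ a) (hs : 0 ≤ s) (hsT : s ≤ T) (hT : 1 ≤ T) :
    (a + 1) * (T * Real.sqrt T) * ((T + a ^ 2) ^ 3)⁻¹ ≤ 27 * ((a + 1) * (((s + (a + 1) ^ 2) * Real.sqrt (s + (a + 1) ^ 2)))⁻¹) := by
  set b : ℝ := a + 1 with hb
  have hb1 : 1 ≤ b := by rw [hb]; linarith
  have hTa : 0 < T + a ^ 2 := by positivity
  have hTb : 0 < T + b ^ 2 := by positivity
  have hsb : 0 < s + b ^ 2 := by positivity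
  -- `3(T + a²) ≥ T + b²`
  have h3 : T + b ^ 2 ≤ 3 * (T + a ^ 2) := by rw [hb]; nlinarith [sq_nonneg (a - 1)]
  have hcube : ((T + a ^ 2) ^ 3)⁻¹ ≤ 27 * ((T + b ^ 2) ^ 3)⁻¹ := by
    rw [show (27 : ℝ) * ((T + b ^ 2) ^ 3)⁻¹ = ((T + b ^ 2) ^ 3 / 27)⁻¹ by rw [inv_div]; ring]
    apply inv_anti₀ (by positivity)
    have : (T + b ^ 2) ^ 3 ≤ (3 * (T + a ^ 2)) ^ 3 := pow_le_pow_left₀ hTb.le h3 3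
    nlinarith
  -- `T√T ≤ (T + b²)√(T + b²)` and `(T+b²)³ = ((T+b²)√(T+b²))²·…`
  have hsqT : Real.sqrt T ≤ Real.sqrt (T + b ^ 2) := Real.sqrt_le_sqrt (by nlinarith)
  have hTT : T * Real.sqrt T ≤ (T + b ^ 2) * Real.sqrt (T + b ^ 2) :=
    mul_le_mul (by nlinarith) hsqT (Real.sqrt_nonneg _) hTb.le
  have hss : Real.sqrt (T + b ^ 2) * Real.sqrt (T + b ^ 2) = T + b ^ 2 := Real.mul_self_sqrt hTb.le
  have hsq0 : 0 < Real.sqrt (T + b ^ 2) := Real.sqrt_pos.2 hTb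
  have hstep : T * Real.sqrt T * ((T + b ^ 2) ^ 3)⁻¹ ≤ ((T + b ^ 2) * Real.sqrt (T + b ^ 2))⁻¹ := by
    rw [show ((T + b ^ 2) * Real.sqrt (T + b ^ 2))⁻¹ = (T + b ^ 2) * Real.sqrt (T + b ^ 2) * ((T + b ^ 2) ^ 3)⁻¹ * 1 by
      field_simp
      nlinarith [hss]]
    rw [mul_one]
    exact mul_le_mul_of_nonneg_right hTT (by positivity)
  -- `s ≤ T` in the last denominator
  have hsT' : ((T + b ^ 2) * Real.sqrt (T + b ^ 2))⁻¹ ≤ ((s + b ^ 2) * Real.sqrt (s + b ^ 2))⁻¹ := by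
    apply inv_anti₀ (by positivity)
    exact mul_le_mul (by linarith) (Real.sqrt_le_sqrt (by linarith)) (Real.sqrt_nonneg _) hTb.le
  calc (a + 1) * (T * Real.sqrt T) * ((T + a ^ 2) ^ 3)⁻¹
      ≤ (a + 1) * (T * Real.sqrt T) * (27 * ((T + b ^ 2) ^ 3)⁻¹) := by gcongr
    _ = 27 * ((a + 1) * (T * Real.sqrt T * ((T + b ^ 2) ^ 3)⁻¹)) := by ring
    _ ≤ 27 * ((a + 1) * ((T + b ^ 2) * Real.sqrt (T + b ^ 2))⁻¹) := by gcongr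
    _ ≤ 27 * ((a + 1) * ((s + b ^ 2) * Real.sqrt (s + b ^ 2))⁻¹) := by gcongr

/-! ## §4 ★★★ The gradient of `G̃₂` is bounded in `d = 3` -/

/-- ★★★ **THE FIRST DIFFERENCE OF THE BIHARMONIC TORUS GREEN FUNCTION IS BOUNDED IN `d = 3`, UNIFORMLY IN THE PERIOD AND THE POINT** — from the displayed small-distance row `h1` of the
one-dimensional torus heat kernel (row (R1)): there is `C` such that for every `L ≥ 1`, every `G : (ℤ/Lℤ)³ → ℝ` with `G(z) = L⁻³Σ_{k≠0}cos(p_k·z)∕ε(p_k)²` (displayed definition, instantiate by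
`rfl`), every direction `i` and EVERY `z`:  `|G(z+eᵢ) − G(z)| ≤ C`  — the lattice form of `∇(c|x|) = O(1)`.  Heat part `≤ ∫₀^{L²} 27K(|z̃ᵢ|+1)((s+b²)√(s+b²))⁻¹ds ≤ 54K` (§2, §3, §1 with
`c = b² = (|z̃ᵢ|+1)²`), tail `≤ (π∕16)C₁³` (✓ `abs_torusGreen2_grad_tail_le`); `C = 54K + (π∕16)C₁³`. [folklore] -/
theorem abs_torusGreen2_grad_le_of_smallDist {K₁ : ℝ}
    (h1 : ∀ (L : ℕ) [NeZero L] (t : ℝ), 0 < t → t ≤ (L : ℝ) ^ 2 → ∀ m : ZMod L,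
      |torusHeatKernel t (m + 1) - torusHeatKernel t m| ≤
        K₁ * ((|((m.valMinAbs : ℤ) : ℝ)| + 1) / t) * (max 1 t) ^ (-(1 / 2 : ℝ)) * ((1 + ((m.valMinAbs : ℤ) : ℝ) ^ 2 / max 1 t) ^ 3)⁻¹) :
    ∃ C : ℝ, ∀ (L : ℕ) [NeZero L] (G : TorusSite 3 L → ℝ),
      (∀ z, G z = (∑ k ∈ (univ : Finset (TorusSite 3 L)).erase 0,
        Real.cos (∑ i, latticeMomentum L k i * ((z i).val : ℝ)) / dispersion (latticeMomentum L k) ^ 2) / (L : ℝ) ^ 3) →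
      ∀ (i : Fin 3) (z : TorusSite 3 L), |G (z + Pi.single i 1) - G z| ≤ C := by
  obtain ⟨K, hK, hP⟩ := mul_abs_grad_prod_torusHeatKernel_le_of_smallDist h1
  set C₁ : ℝ := ∑' n : ℤ, (1 / 2 : ℝ) ^ n.natAbs with hC₁
  refine ⟨54 * K + π / 16 * C₁ ^ 3, ?_⟩
  intro L _ G hG i z
  have hL : (0 : ℝ) < L := by exact_mod_cast Nat.pos_of_ne_zero (NeZero.ne L)
  have hS : (0 : ℝ) ≤ (L : ℝ) ^ 2 := by positivity
  rw [hG, hG, torusGreen2_grad_eq z i ((L : ℝ) ^ 2)]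
  set a : ℝ := |(((z i).valMinAbs : ℤ) : ℝ)| with ha
  have ha0 : 0 ≤ a := abs_nonneg _
  set b : ℝ := a + 1 with hb
  have hb0 : 0 < b := by rw [hb]; linarith
  -- the heat-kernel part
  have hmain : |∫ s in (0 : ℝ)..(L : ℝ) ^ 2,
      s * ((∏ μ, torusHeatKernel s ((z + Pi.single i 1 : TorusSite 3 L) μ)) - ∏ μ, torusHeatKernel s (z μ))| ≤ 54 * K := by
    have hb' : ∀ s ∈ Set.Ioc (0 : ℝ) ((L : ℝ) ^ 2),
        |s * ((∏ μ, torusHeatKernel s ((z + Pi.single i 1 : TorusSite 3 L) μ)) - ∏ μ, torusHeatKernel s (z μ))|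
          ≤ 27 * K * (b * ((s + b ^ 2) * Real.sqrt (s + b ^ 2))⁻¹) := by
      intro s hs
      rw [abs_mul, abs_of_pos hs.1]
      refine (hP L s hs.1 hs.2 z i).trans ?_
      set T : ℝ := max 1 s with hT
      have hT1 : 1 ≤ T := le_max_left _ _
      have hsT : s ≤ T := le_max_right _ _
      have h := pointwise_majorant ha0 hs.1.le hsT hT1
      rw [ha, sq_abs, ← ha, ← hb] at h
      rw [← ha, ← hb]
      calc K * b * (T * Real.sqrt T) * ((T + (((z i).valMinAbs : ℤ) : ℝ) ^ 2) ^ 3)⁻¹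
          = K * (b * (T * Real.sqrt T) * ((T + (((z i).valMinAbs : ℤ) : ℝ) ^ 2) ^ 3)⁻¹) := by ring
        _ ≤ K * (27 * (b * ((s + b ^ 2) * Real.sqrt (s + b ^ 2))⁻¹)) := mul_le_mul_of_nonneg_left h hK.le
        _ = 27 * K * (b * ((s + b ^ 2) * Real.sqrt (s + b ^ 2))⁻¹) := by ring
    have hcont : IntervalIntegrable (fun s : ℝ => 27 * K * (b * ((s + b ^ 2) * Real.sqrt (s + b ^ 2))⁻¹)) volume 0 ((L : ℝ) ^ 2) := by
      refine ContinuousOn.intervalIntegrable ?_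
      rw [Set.uIcc_of_le hS]
      refine continuousOn_const.mul (continuousOn_const.mul (ContinuousOn.inv₀ (by fun_prop) fun s hs => ?_))
      have hsc : 0 < s + b ^ 2 := by have := hs.1; positivity
      have : 0 < Real.sqrt (s + b ^ 2) := Real.sqrt_pos.2 hsc
      positivity
    calc _ ≤ ∫ s in (0 : ℝ)..(L : ℝ) ^ 2, 27 * K * (b * ((s + b ^ 2) * Real.sqrt (s + b ^ 2))⁻¹) := by
          have h := intervalIntegral.norm_integral_le_of_norm_le hS
            (Filter.Eventually.of_forall fun s hs => (Real.norm_eq_abs _).le.trans (hb' s hs)) hcont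
          rwa [Real.norm_eq_abs] at h
      _ = 27 * K * (b * ∫ s in (0 : ℝ)..(L : ℝ) ^ 2, ((s + b ^ 2) * Real.sqrt (s + b ^ 2))⁻¹) := by
          rw [intervalIntegral.integral_const_mul, intervalIntegral.integral_const_mul]
      _ ≤ 27 * K * (b * (2 / Real.sqrt (b ^ 2))) := by
          gcongr
          exact integral_inv_mul_sqrt_le (by positivity) hS
      _ = 54 * K := by
          rw [Real.sqrt_sq hb0.le]
          field_simp
          ring
  -- the tail
  have htail := abs_torusGreen2_grad_tail_le z i
  rw [← hC₁] at htail
  have hL3 : π / 16 * C₁ ^ 3 * (L : ℝ) ^ 3 / (L : ℝ) ^ 3 = π / 16 * C₁ ^ 3 := by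
    field_simp
  rw [hL3] at htail
  exact (abs_add_le _ _).trans (add_le_add hmain htail)

/-! ## §5 ★★★ Row (R2), unconditional -/

/-- ★★★ **ROW (R2): THE FIRST DIFFERENCE OF THE BIHARMONIC TORUS GREEN FUNCTION IS BOUNDED IN `d = 3`, UNIFORMLY IN THE PERIOD AND THE POINT.**  There is an absolute constant `C` such that
for every `L ≥ 1`, every `G : (ℤ/Lℤ)³ → ℝ` with `G(z) = L⁻³Σ_{k≠0}cos(p_k·z)∕ε(p_k)²` (displayed definition, instantiate by `rfl`), every direction `i` and every `z`:  `|G(z+eᵢ) − G(z)| ≤ C`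
— §4 with its displayed small-distance row discharged by ✓ `Prop7TorusHeatKernelSmallDistance.abs_torusHeatKernel_fwdDiff_le_small` (row (R1), routeR-w2 g5).  The lattice, finite-volume
form of `∇(c|x|) = O(1)` for the biharmonic potential of `ℝ³`; consumed by the (A3) peeling `χ·∇_bG̃₂` of the (hK) kernel. [folklore] -/
theorem abs_torusGreen2_grad_le : ∃ C : ℝ, ∀ (L : ℕ) [NeZero L] (G : TorusSite 3 L → ℝ),
      (∀ z, G z = (∑ k ∈ (univ : Finset (TorusSite 3 L)).erase 0,
        Real.cos (∑ i, latticeMomentum L k i * ((z i).val : ℝ)) / dispersion (latticeMomentum L k) ^ 2) / (L : ℝ) ^ 3) →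
      ∀ (i : Fin 3) (z : TorusSite 3 L), |G (z + Pi.single i 1) - G z| ≤ C := by
  obtain ⟨K₁, -, h1⟩ := abs_torusHeatKernel_fwdDiff_le_small
  exact abs_torusGreen2_grad_le_of_smallDist h1

end Summit.QuantumFields.YangMills.Theorems.Prop7TorusGreen2GradientBound
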